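import Summits.QuantumFields.YangMills.Theorems.AllWindowsColdBoxBoxHighLineRestBlockBoxLap
import Summits.QuantumFields.YangMills.Theorems.AllWindowsColdBoxBoxHighLineKernelHodgeForm
import Summits.QuantumFields.YangMills.Theorems.AllWindowsColdBoxSchurJaffardDecay

/-!
# LINE-19 S3b / LINE-20 U1 — STUB-PLAN-U1 §7.4: the skin/rest block form of `hodgeQ` and the ASSEMBLY of S3 modulo its analytic inputs

The Hodge precision matrix of the cold box, reindexed along `skinRest : Skin H ⊕ Rest H ≃ LandauFree H`, is the block matrix
`fromBlocks (skinBlock H) (coupling H) (coupling H)ᵀ (restBlock H)` (`hodgeQ_reindex_eq_fromBlocks`), with `restBlock H * restInv H = 1`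
(file `…RestBlockBoxLap`).  The distance of two links is the `ℓ∞` distance of their base points (`linkDist`, a pseudo-metric), and the skin
— the links lying in a face of the cube — has cubic growth: `card_skin_ball_le`.  Feeding these to the abstract Schur–Jaffard theorem
`Jaffard.schur_jaffard_decay` (✓p727934, `D_S = 3 < 7/2`) gives **`landauKernelBounds_of_inputs`**: stub S3
`LandauVarianceBounded ∧ LandauKernelDecay` follows from four UNIFORM analytic inputs on the blocks — (h1) size decay of `restInv`, (h2)
gradient-type decay of `restInv * couplingᵀ`, (J′2) coercivity `schurSkin ≥ 1` and (h3) `(1+d)⁻⁴` decay of the skin Schur complement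
`schurSkin = skinBlock − coupling * restInv * couplingᵀ` — each the subject of its own file (the landed BoxKernel package supplies the
estimates).  No `log H` is lost or needed: the typed `(1 + log H)` of S3b is slack.

Everything proved; standard axioms.  HONEST LABEL: the assembly of stub S3 (⟨stmt-QuantumFields-24004⟩/⟨24335⟩; U1a/S3b of ⟨24336⟩) of a
critic-stamped line on the R2ξ″ crux, CONDITIONAL on the four named inputs; S3 is NOT closed by this file; no crux, rung or summit is proved;
the Yang–Mills mass gap is NOT proved by this file.
-/

set_option autoImplicit false

noncomputable section

namespace Summit.QuantumFields.YangMills.Theorems.AllWindowsColdBoxBoxHighLine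

open Finset Matrix
open Literature.Probability.LatticeModels (Site)
open Literature.MathematicalPhysics.QuantumFieldTheory
open Literature.MathematicalPhysics.QuantumFieldTheory.LatticeMaxwell
open Literature.MathematicalPhysics.QuantumFieldTheory.AxialGauge
open Summit.QuantumFields.YangMills.Theorems.WeakCouplingRates
open Summit.QuantumFields.YangMills.Theorems.AllWindowsColdBox.BoxKernel

namespace RestBlock

variable {H : ℕ}

/-! ## The skin/rest reindexing and the blocks -/

/-- `Skin H ⊕ Rest H ≃ LandauFree H` (skin first). -/
def skinRest (H : ℕ) : Skin H ⊕ Rest H ≃ LandauFree H :=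
  (Equiv.sumComm (Skin H) (Rest H)).trans
    (Equiv.sumCompl fun e : LandauFree H => e.1.1.1 ∈ interiorSites H ∨ e.1.1.1 + Pi.single e.1.1.2 1 ∈ interiorSites H)

/-- `skinRest` on a skin link. -/
@[simp] theorem skinRest_inl (s : Skin H) : skinRest H (Sum.inl s) = s.1 := rfl

/-- `skinRest` on a rest link. -/
@[simp] theorem skinRest_inr (r : Rest H) : skinRest H (Sum.inr r) = r.1 := rfl

variable (H) in
/-- The skin × skin block `A` of `hodgeQ`. -/
def skinBlock : Matrix (Skin H) (Skin H) ℝ := Matrix.of fun s s' => hodgeQ H s.1 s'.1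

variable (H) in
/-- The skin × rest coupling block `C` of `hodgeQ`. -/
def coupling : Matrix (Skin H) (Rest H) ℝ := Matrix.of fun s r => hodgeQ H s.1 r.1

variable (H) in
/-- The Schur complement of the rest block onto the skin: `M′ = A − C·K⁻¹·Cᵀ`. -/
def schurSkin : Matrix (Skin H) (Skin H) ℝ := skinBlock H - coupling H * restInv H * (coupling H)ᵀ

/-- **`hodgeQ` in skin/rest block form.** -/
theorem hodgeQ_reindex_eq_fromBlocks :
    Matrix.reindex (skinRest H).symm (skinRest H).symm (hodgeQ H) =
      Matrix.fromBlocks (skinBlock H) (coupling H) (coupling H)ᵀ (restBlock H) := by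
  ext a b
  rcases a with s | r <;> rcases b with s' | r'
  · simp [skinBlock]
  · simp [coupling]
  · simp only [Matrix.reindex_apply, Matrix.submatrix_apply, Equiv.symm_symm, skinRest_inr, skinRest_inl, Matrix.fromBlocks_apply₂₁,
      Matrix.transpose_apply, coupling, Matrix.of_apply]
    have h := congrFun (congrFun (hodgeQ_transpose H) r.1) s'.1
    rw [Matrix.transpose_apply] at h
    exact h.symm
  · simp [restBlock]

/-- The skin block is symmetric. -/
theorem skinBlock_isSymm : (skinBlock H).IsSymm := by
  ext s s'
  simp only [Matrix.transpose_apply, skinBlock, Matrix.of_apply]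
  have h := congrFun (congrFun (hodgeQ_transpose H) s.1) s'.1
  rw [Matrix.transpose_apply] at h
  exact h

/-- `restInv` is symmetric. -/
theorem restInv_isSymm : (restInv H).IsSymm := restInv_transpose

/-- **The entries of `hodgeQ⁻¹` are those of the inverse block matrix** (the `DecidableEq` instance of the index sum is given
explicitly: the instance search does not find it by itself through the nested subtypes). -/
theorem hodgeQ_inv_apply (e e' : LandauFree H) :
    (hodgeQ H)⁻¹ e e' =
      @Inv.inv _ (@Matrix.inv _ _ _ instDecidableEqSum _)
        (Matrix.fromBlocks (skinBlock H) (coupling H) (coupling H)ᵀ (restBlock H)) ((skinRest H).symm e) ((skinRest H).symm e') := by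
  letI : DecidableEq (Skin H ⊕ Rest H) := instDecidableEqSum
  rw [← hodgeQ_reindex_eq_fromBlocks, Matrix.inv_reindex]
  simp [Matrix.reindex_apply]

/-! ## The `ℓ∞` distance of base points -/

/-- The `ℓ∞` distance of the base points of two links (the distance of the typed statement `LandauKernelDecay`). -/
def linkDist (e e' : LandauFree H) : ℝ := ⨆ k : Fin 4, |((e.1.1.1 k - e'.1.1.1 k : ℤ) : ℝ)|

/-- Each coordinate difference is bounded by the distance. -/
theorem abs_sub_le_linkDist (e e' : LandauFree H) (k : Fin 4) : |((e.1.1.1 k - e'.1.1.1 k : ℤ) : ℝ)| ≤ linkDist e e' :=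
  le_ciSup (f := fun k : Fin 4 => |((e.1.1.1 k - e'.1.1.1 k : ℤ) : ℝ)|) (Set.finite_range _).bddAbove k

/-- The distance is attained at some coordinate. -/
theorem exists_linkDist_eq (e e' : LandauFree H) : ∃ k : Fin 4, linkDist e e' = |((e.1.1.1 k - e'.1.1.1 k : ℤ) : ℝ)| := by
  obtain ⟨k, hk⟩ := exists_eq_ciSup_of_finite (f := fun k : Fin 4 => |((e.1.1.1 k - e'.1.1.1 k : ℤ) : ℝ)|)
  exact ⟨k, hk.symm⟩

/-- `linkDist ≥ 0`. -/
theorem linkDist_nonneg (e e' : LandauFree H) : 0 ≤ linkDist e e' :=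
  (abs_nonneg _).trans (abs_sub_le_linkDist e e' 0)

/-- `linkDist e e = 0`. -/
theorem linkDist_self (e : LandauFree H) : linkDist e e = 0 := by
  simp [linkDist]

/-- Symmetry. -/
theorem linkDist_comm (e e' : LandauFree H) : linkDist e e' = linkDist e' e := by
  unfold linkDist
  congr 1
  funext k
  rw [← abs_neg]
  congr 1
  push_cast
  ring

/-- Triangle inequality. -/
theorem linkDist_triangle (e e' e'' : LandauFree H) : linkDist e e' ≤ linkDist e e'' + linkDist e'' e' := by
  apply ciSup_le
  intro k
  have h1 := abs_sub_le_linkDist e e'' k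
  have h2 := abs_sub_le_linkDist e'' e' k
  have : |((e.1.1.1 k - e'.1.1.1 k : ℤ) : ℝ)| ≤ |((e.1.1.1 k - e''.1.1.1 k : ℤ) : ℝ)| + |((e''.1.1.1 k - e'.1.1.1 k : ℤ) : ℝ)| := by
    have := abs_add_le (((e.1.1.1 k - e''.1.1.1 k : ℤ) : ℝ)) (((e''.1.1.1 k - e'.1.1.1 k : ℤ) : ℝ))
    push_cast at this ⊢
    simpa [sub_add_sub_cancel] using this
  linarith

variable (H) in
/-- The distance on `Skin H ⊕ Rest H`. -/
def sumDist (a b : Skin H ⊕ Rest H) : ℝ := linkDist (skinRest H a) (skinRest H b)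

/-! ## Cubic growth of the skin -/

/-- The coordinates of a free edge lie in `[0, 2H]`. -/
theorem coord_bounds (e : LandauFree H) (k : Fin 4) : 0 ≤ e.1.1.1 k ∧ e.1.1.1 k ≤ 2 * (H : ℤ) := by
  have h := free_mem_boxEdges e
  have hE : e.1.1 = (e.1.1.1, e.1.1.2) := rfl
  rw [hE, mem_boxEdges_iff] at h
  have := h.1 k
  push_cast at this
  omega

/-- **A skin link lies in a face**: some coordinate of its base point is `0` or `2H`. -/
theorem exists_face_of_skin (s : Skin H) : ∃ ν : Fin 4, s.1.1.1.1 ν = 0 ∨ s.1.1.1.1 ν = 2 * (H : ℤ) := by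
  have h := s.2
  have hx : s.1.1.1.1 ∉ interiorSites H := fun hc => h (Or.inl hc)
  rw [mem_interiorSites_iff] at hx
  simp only [not_forall] at hx
  obtain ⟨ν, hν⟩ := hx
  have hb := coord_bounds s.1 ν
  exact ⟨ν, by omega⟩

/-- A face direction of a skin link. -/
def faceDir (s : Skin H) : Fin 4 := Classical.choose (exists_face_of_skin s)

/-- Its defining property. -/
theorem faceDir_spec (s : Skin H) : s.1.1.1.1 (faceDir s) = 0 ∨ s.1.1.1.1 (faceDir s) = 2 * (H : ℤ) :=
  Classical.choose_spec (exists_face_of_skin s)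

/-- The code of a skin link relative to a base point `y`: direction, face direction, which face, and the three remaining relative
coordinates. -/
def skinCode (y : Site 4) (s : Skin H) : Fin 4 × Fin 4 × Bool × (Fin 3 → ℤ) :=
  (s.1.1.1.2, faceDir s, decide (s.1.1.1.1 (faceDir s) = 0), fun j => s.1.1.1.1 ((faceDir s).succAbove j) - y ((faceDir s).succAbove j))

/-- The code is injective. -/
theorem skinCode_injective (y : Site 4) : Function.Injective (skinCode (H := H) y) := by
  intro s s' h
  simp only [skinCode, Prod.mk.injEq] at h
  obtain ⟨hdir, hν, hb, hg⟩ := h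
  rw [← hν] at hb
  have hx : s.1.1.1.1 = s'.1.1.1.1 := by
    funext k
    by_cases hk : k = faceDir s
    · have h1 := faceDir_spec s
      have h2 := faceDir_spec s'
      rw [← hν] at h2
      rw [hk]
      by_cases h0 : s.1.1.1.1 (faceDir s) = 0
      · have : s'.1.1.1.1 (faceDir s) = 0 := by simpa [h0] using hb.symm
        rw [h0, this]
      · have : ¬ s'.1.1.1.1 (faceDir s) = 0 := by simpa [h0] using hb.symm
        omega
    · obtain ⟨j, hj⟩ := Fin.exists_succAbove_eq hk
      have := congrFun hg j
      rw [hν] at hj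
      rw [← hν] at this hj
      rw [hj] at this
      omega
  apply Subtype.ext; apply Subtype.ext; apply Subtype.ext
  exact Prod.ext hx hdir

/-- **Cubic growth of the skin**: the skin links within `ℓ∞`-distance `ρ` of any link number at most `256·(1+ρ)³`. -/
theorem card_skin_ball_le (e : LandauFree H) (ρ : ℝ) (hρ : 0 ≤ ρ) :
    ((Finset.univ.filter (fun s : Skin H => linkDist s.1 e ≤ ρ)).card : ℝ) ≤ 256 * (1 + ρ) ^ (3 : ℝ) := by
  set n : ℕ := ⌊ρ⌋₊ with hn
  set T : Finset (Fin 4 × Fin 4 × Bool × (Fin 3 → ℤ)) :=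
    (Finset.univ ×ˢ (Finset.univ ×ˢ (Finset.univ ×ˢ Fintype.piFinset (fun _ : Fin 3 => Finset.Icc (-(n : ℤ)) n)))) with hT
  have hmaps : Set.MapsTo (skinCode (H := H) e.1.1.1) ↑(Finset.univ.filter (fun s : Skin H => linkDist s.1 e ≤ ρ)) ↑T := by
    intro s hs
    rw [Finset.coe_filter, Set.mem_setOf_eq] at hs
    simp only [hT, Finset.coe_product, Finset.coe_univ, Set.mem_prod, Set.mem_univ, true_and, Fintype.coe_piFinset, Set.mem_pi,
      Finset.coe_Icc, Set.mem_Icc, skinCode]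
    intro j
    set k := (faceDir s).succAbove j
    have h1 : |((s.1.1.1.1 k - e.1.1.1 k : ℤ) : ℝ)| ≤ ρ := (abs_sub_le_linkDist s.1 e k).trans hs.2
    have h2 : ((s.1.1.1.1 k - e.1.1.1 k).natAbs : ℕ) ≤ n := by
      apply Nat.le_floor
      have : (((s.1.1.1.1 k - e.1.1.1 k).natAbs : ℕ) : ℝ) = |((s.1.1.1.1 k - e.1.1.1 k : ℤ) : ℝ)| := by
        rw [Nat.cast_natAbs, Int.cast_abs]
      rw [this]; exact h1
    exact fun _ => ⟨by omega, by omega⟩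
  have hcard := Finset.card_le_card_of_injOn (skinCode (H := H) e.1.1.1) hmaps ((skinCode_injective e.1.1.1).injOn)
  have hI : (Finset.Icc (-(n : ℤ)) n).card = 2 * n + 1 := by
    rw [Int.card_Icc]; omega
  have hT' : T.card = 4 * (4 * (2 * (2 * n + 1) ^ 3)) := by
    simp only [hT, Finset.card_product, Finset.card_univ, Fintype.card_fin, Fintype.card_bool, Fintype.card_piFinset, hI,
      Finset.prod_const, Finset.card_univ, Fintype.card_fin]
  have hnρ : (n : ℝ) ≤ ρ := Nat.floor_le hρ
  calc ((Finset.univ.filter (fun s : Skin H => linkDist s.1 e ≤ ρ)).card : ℝ) ≤ T.card := by exact_mod_cast hcard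
    _ = 32 * (2 * n + 1) ^ 3 := by rw [hT']; push_cast; ring
    _ ≤ 32 * (2 * (1 + ρ)) ^ 3 := by
        apply mul_le_mul_of_nonneg_left _ (by norm_num)
        apply pow_le_pow_left₀ (by positivity)
        linarith
    _ = 256 * (1 + ρ) ^ (3 : ℝ) := by
        rw [show ((3 : ℝ)) = ((3 : ℕ) : ℝ) by norm_num, Real.rpow_natCast]
        ring

/-! ## The assembly of S3 modulo its analytic inputs -/

/-- **Stub S3 from the four uniform block inputs** (h1: size decay of `restInv`; h2: gradient-type decay of `restInv * couplingᵀ`;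
J′2: `schurSkin ≥ 1`; h3: `(1+d)⁻⁴` decay of `schurSkin`), by the abstract Schur–Jaffard theorem with `D_S = 3`. -/
theorem landauKernelBounds_of_inputs {c₁ c₂ c₃ : ℝ} (hc₁ : 0 ≤ c₁) (hc₂ : 0 ≤ c₂) (hc₃ : 0 ≤ c₃)
    (h1 : ∀ H : ℕ, 1 ≤ H → ∀ r r' : Rest H, |restInv H r r'| * (1 + linkDist r.1 r'.1) ^ (2 : ℝ) ≤ c₁)
    (h2 : ∀ H : ℕ, 1 ≤ H → ∀ (r : Rest H) (s : Skin H), |(restInv H * (coupling H)ᵀ) r s| * (1 + linkDist r.1 s.1) ^ (3 : ℝ) ≤ c₂)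
    (hJ : ∀ H : ℕ, 1 ≤ H → ∀ v : Skin H → ℝ, 1 * ∑ s, v s ^ 2 ≤ v ⬝ᵥ (schurSkin H *ᵥ v))
    (h3 : ∀ H : ℕ, 1 ≤ H → ∀ s s' : Skin H, |schurSkin H s s'| * (1 + linkDist s.1 s'.1) ^ (4 : ℝ) ≤ c₃) :
    LandauVarianceBounded ∧ LandauKernelDecay := by
  obtain ⟨Cfin, hC0, hmain⟩ := Summit.QuantumFields.YangMills.Theorems.AllWindowsColdBox.Jaffard.schur_jaffard_decay.{0} (DS := 3) (cS := 256) (c₁ := c₁) (c₂ := c₂) (c₃ := c₃) (m₀ := 1)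
    (by norm_num) (by norm_num) (by norm_num) hc₁ hc₂ hc₃ one_pos
  -- the uniform entry bound
  have key : ∀ H : ℕ, 1 ≤ H → ∀ e e' : LandauFree H, |(hodgeQ H)⁻¹ e e'| * (1 + linkDist e e') ^ (2 : ℝ) ≤ Cfin := by
    intro H hH e e'
    haveI : NeZero H := ⟨by omega⟩
    letI : DecidableEq (Skin H ⊕ Rest H) := instDecidableEqSum
    have hd0 : ∀ a b : Skin H ⊕ Rest H, 0 ≤ sumDist H a b := fun a b => linkDist_nonneg _ _
    have hdd : ∀ a : Skin H ⊕ Rest H, sumDist H a a = 0 := fun a => linkDist_self _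
    have hds : ∀ a b : Skin H ⊕ Rest H, sumDist H a b = sumDist H b a := fun a b => linkDist_comm _ _
    have hdt : ∀ a b c : Skin H ⊕ Rest H, sumDist H a b ≤ sumDist H a c + sumDist H c b := fun a b c => linkDist_triangle _ _ _
    have hgr : ∀ (y : Skin H ⊕ Rest H) (ρ : ℝ), 0 ≤ ρ →
        ((Finset.univ.filter (fun s : Skin H => sumDist H (Sum.inl s) y ≤ ρ)).card : ℝ) ≤ 256 * (1 + ρ) ^ (3 : ℝ) :=
      fun y ρ hρ => card_skin_ball_le (skinRest H y) ρ hρ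
    have hm := hmain (sumDist H) hd0 hdd hds hdt hgr (skinBlock H) (coupling H) (restBlock H) (restInv H) skinBlock_isSymm
      restInv_isSymm restBlock_mul_restInv (fun r r' => h1 H hH r r') (fun r s => h2 H hH r s) (hJ H hH) (fun s s' => h3 H hH s s')
      ((skinRest H).symm e) ((skinRest H).symm e')
    have hde : sumDist H ((skinRest H).symm e) ((skinRest H).symm e') = linkDist e e' := by
      simp [sumDist]
    rw [hde] at hm
    rw [hodgeQ_inv_apply e e']
    exact hm
  refine ⟨⟨Cfin, fun H hH e => ?_⟩, ⟨Cfin, fun H hH e e' => ?_⟩⟩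
  · have h := key H hH e e
    rw [linkDist_self, add_zero, Real.one_rpow, mul_one] at h
    exact (le_abs_self _).trans h
  · have h := key H hH e e'
    have hd0 : 0 ≤ linkDist e e' := linkDist_nonneg e e'
    have hlog : 0 ≤ Real.log H := Real.log_nonneg (by exact_mod_cast hH)
    have hpow : (1 + linkDist e e') ^ (2 : ℝ) = (1 + linkDist e e') ^ 2 := by
      rw [show ((2 : ℝ)) = ((2 : ℕ) : ℝ) by norm_num, Real.rpow_natCast]
    rw [hpow] at h
    have hpos : 0 < (1 + linkDist e e') ^ 2 := by positivity
    change |(hodgeQ H)⁻¹ e e'| ≤ Cfin * (1 + Real.log H) / (1 + linkDist e e') ^ 2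
    rw [le_div_iff₀ hpos]
    calc |(hodgeQ H)⁻¹ e e'| * (1 + linkDist e e') ^ 2 ≤ Cfin := h
      _ ≤ Cfin * (1 + Real.log H) := by nlinarith

end RestBlock

end Summit.QuantumFields.YangMills.Theorems.AllWindowsColdBoxBoxHighLine

end
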